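import Mathlib
import HarnessLib

/-!
# No common invariant subspace for the Weil tangent family: along a very general direction no abelian
# subvariety of `E_ω⁶` survives (WEIL-2 gen 25, LEMMA I^gen)

research route, not a corollary; conditional on HC_CM plus one named minimal statement.

Cell `pub-hodge-ring2-ab-*` (ALL ABELIAN VARIETIES), seat WEIL-2 gen 25, §2.3 (LEMMA I^gen) of
`run/shared/lean/pub/pub-hodge-ring2/pub-hodge-ring2-ab-weil-2/LIMITS-G25.md`.

Informal setting (not formalised).  On `Y₀ = E_ω⁶` the tangent space of the Weil family is
`T S = {k_X = [[0, X], [d₋⁻¹ Xᵀ d₊, 0]] : X ∈ M₃}` and a translated abelian subvariety with (K-rational) tangent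
space `U ⊂ K⁶ = K³₊ × K³₋` survives to first order along `κ_X` iff `k_X Ū ⊂ U`, i.e. iff `U` is stable under
`(u₊, u₋) ↦ (X ū₋, d₋⁻¹ Xᵀ d₊ ū₊)`.  For a FIXED `U` this is a linear condition on `X`, so «no abelian subvariety
survives a very general direction» is equivalent to: no proper non-zero `U` is stable under the WHOLE family
`{J_X : X ∈ M₃}`.  Suppressing the (coordinatewise) conjugation and absorbing the invertible diagonal factors into two
weight vectors `d₁, d₂` with non-zero entries (exactly as in the span-lemma file `Ring2AbelianAllNonsplitXiSpan`), the
algebraic core is the statement proved here, over any field and any index type with at least two elements: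

* `eq_bot_or_eq_top_of_forall_weilTangent_mem` — if a subspace `U ≤ L^ι × L^ι` satisfies
  `(d₁ • X u₋, d₂ • Xᵀ u₊) ∈ U` (weights entrywise) for all `u ∈ U` and ALL square matrices `X`, then `U = ⊥` or `U = ⊤`.

Consequence in the account (LIMITS-G25 §2.3 (ii)–(iii)): for `κ` outside a countable union of proper linear subspaces
of `T S` no translated abelian subvariety of `Y₀` survives `κ` even to first order (cell and split sibling alike), so the
flat limit that THEOREM L attaches to a very general direction is «block-free».

0 sorry, no `def`, no named fact; `HC_CM` does not occur.

## References

* [vanGeemen1994HodgeAV] B. van Geemen, An introduction to the Hodge conjecture for abelian varieties, LNM 1594, §5 —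
  the tangent space of a Weil-type family as `Hom(V₊, V̄₋)` (context only).
-/

namespace Summit.HodgeConjecture.Ring2AbelianAll.NonsplitGenericDirection

open Matrix

variable {L : Type*} [Field L] {ι : Type*} [Fintype ι] [DecidableEq ι]

/-- The value of the tangent map `J_X` attached to the matrix `X` on a pair `u = (u₊, u₋)`:
`(a ↦ d₁ a · (X u₋)_a , b ↦ d₂ b · (Xᵀ u₊)_b)`.  (An abbreviation used only inside statements; no definition is
introduced into the tree's vocabulary.)
research route, not a corollary; conditional on HC_CM plus one named minimal statement. [locator LIMITS-G25 §2.3] -/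
theorem weilTangent_single_apply (d₁ d₂ : ι → L) (u : (ι → L) × (ι → L)) (a b : ι) :
    ((fun a' => d₁ a' * ((Matrix.single a b (1 : L)) *ᵥ u.2) a',
      fun b' => d₂ b' * ((Matrix.single a b (1 : L))ᵀ *ᵥ u.1) b') : (ι → L) × (ι → L))
      = ((d₁ a * u.2 b) • Pi.single a (1 : L), (d₂ b * u.1 a) • Pi.single b (1 : L)) := by
  ext i
  · simp only [Matrix.single_mulVec_eq, one_mul, Pi.smul_apply, smul_eq_mul, Pi.single_apply]
    split_ifs with h
    · subst h; ring
    · ring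
  · simp only [Matrix.transpose_single, Matrix.single_mulVec_eq, one_mul, Pi.smul_apply, smul_eq_mul,
      Pi.single_apply]
    split_ifs with h
    · subst h; ring
    · ring

section

variable {d₁ d₂ : ι → L} {U : Submodule L ((ι → L) × (ι → L))}

/-- **Step 1.** If `U` is stable under all `J_X` and contains a «pure plus» vector `(p, 0)` with `p a₀ ≠ 0`, then it
contains every «pure minus» coordinate vector `(0, e_b)` (apply `J_X` with `X = E_{a₀ b}`).
research route, not a corollary; conditional on HC_CM plus one named minimal statement. [locator LIMITS-G25 §2.3] -/
theorem inr_single_mem_of_inl_mem (hd₂ : ∀ b, d₂ b ≠ 0)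
    (hU : ∀ u ∈ U, ∀ X : Matrix ι ι L,
      ((fun a => d₁ a * (X *ᵥ u.2) a, fun b => d₂ b * (Xᵀ *ᵥ u.1) b) : (ι → L) × (ι → L)) ∈ U)
    {p : ι → L} {a₀ : ι} (hp : ((p, 0) : (ι → L) × (ι → L)) ∈ U) (ha : p a₀ ≠ 0) (b : ι) :
    ((0, Pi.single b (1 : L)) : (ι → L) × (ι → L)) ∈ U := by
  have h := hU _ hp (Matrix.single a₀ b 1)
  rw [weilTangent_single_apply] at h
  simp only [Pi.zero_apply, mul_zero, zero_smul] at h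
  have hc : d₂ b * p a₀ ≠ 0 := mul_ne_zero (hd₂ b) ha
  have h' := U.smul_mem (d₂ b * p a₀)⁻¹ h
  rw [Prod.smul_mk, smul_zero, smul_smul, inv_mul_cancel₀ hc, one_smul] at h'
  exact h'

/-- **Step 2.** Dually, a «pure minus» vector `(0, q)` with `q b₀ ≠ 0` in a `J`-stable `U` puts every `(e_a, 0)` in `U`
(`X = E_{a b₀}`).
research route, not a corollary; conditional on HC_CM plus one named minimal statement. [locator LIMITS-G25 §2.3] -/
theorem inl_single_mem_of_inr_mem (hd₁ : ∀ a, d₁ a ≠ 0)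
    (hU : ∀ u ∈ U, ∀ X : Matrix ι ι L,
      ((fun a => d₁ a * (X *ᵥ u.2) a, fun b => d₂ b * (Xᵀ *ᵥ u.1) b) : (ι → L) × (ι → L)) ∈ U)
    {q : ι → L} {b₀ : ι} (hq : ((0, q) : (ι → L) × (ι → L)) ∈ U) (hb : q b₀ ≠ 0) (a : ι) :
    ((Pi.single a (1 : L), 0) : (ι → L) × (ι → L)) ∈ U := by
  have h := hU _ hq (Matrix.single a b₀ 1)
  rw [weilTangent_single_apply] at h
  simp only [Pi.zero_apply, mul_zero, zero_smul] at h
  have hc : d₁ a * q b₀ ≠ 0 := mul_ne_zero (hd₁ a) hb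
  have h' := U.smul_mem (d₁ a * q b₀)⁻¹ h
  rw [Prod.smul_mk, smul_zero, smul_smul, inv_mul_cancel₀ hc, one_smul] at h'
  exact h'

/-- **Step 3.** If `U` contains all `(e_a, 0)` and all `(0, e_b)` then `U = ⊤`.
research route, not a corollary; conditional on HC_CM plus one named minimal statement. [locator LIMITS-G25 §2.3] -/
theorem eq_top_of_singles_mem
    (h₁ : ∀ a, ((Pi.single a (1 : L), 0) : (ι → L) × (ι → L)) ∈ U)
    (h₂ : ∀ b, ((0, Pi.single b (1 : L)) : (ι → L) × (ι → L)) ∈ U) : U = ⊤ := by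
  rw [eq_top_iff]
  rintro ⟨x, y⟩ -
  have hx : ((x, 0) : (ι → L) × (ι → L)) ∈ U := by
    have : ((x, 0) : (ι → L) × (ι → L)) = ∑ a, x a • ((Pi.single a (1 : L), 0) : (ι → L) × (ι → L)) := by
      ext i
      · simp [Prod.fst_sum, Pi.single_apply]
      · simp [Prod.snd_sum]
    rw [this]
    exact U.sum_mem fun a _ => U.smul_mem _ (h₁ a)
  have hy : ((0, y) : (ι → L) × (ι → L)) ∈ U := by
    have : ((0, y) : (ι → L) × (ι → L)) = ∑ b, y b • ((0, Pi.single b (1 : L)) : (ι → L) × (ι → L)) := by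
      ext i
      · simp [Prod.fst_sum]
      · simp [Prod.snd_sum, Pi.single_apply]
    rw [this]
    exact U.sum_mem fun b _ => U.smul_mem _ (h₂ b)
  simpa using U.add_mem hx hy

/-- **Step 4.** A pure plus vector with a non-zero entry in a `J`-stable `U` already forces `U = ⊤`.
research route, not a corollary; conditional on HC_CM plus one named minimal statement. [locator LIMITS-G25 §2.3] -/
theorem eq_top_of_inl_mem (hd₁ : ∀ a, d₁ a ≠ 0) (hd₂ : ∀ b, d₂ b ≠ 0)
    (hU : ∀ u ∈ U, ∀ X : Matrix ι ι L,
      ((fun a => d₁ a * (X *ᵥ u.2) a, fun b => d₂ b * (Xᵀ *ᵥ u.1) b) : (ι → L) × (ι → L)) ∈ U)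
    {p : ι → L} {a₀ : ι} (hp : ((p, 0) : (ι → L) × (ι → L)) ∈ U) (ha : p a₀ ≠ 0) : U = ⊤ := by
  have h₂ : ∀ b, ((0, Pi.single b (1 : L)) : (ι → L) × (ι → L)) ∈ U :=
    inr_single_mem_of_inl_mem hd₂ hU hp ha
  have h₁ : ∀ a, ((Pi.single a (1 : L), 0) : (ι → L) × (ι → L)) ∈ U := fun a =>
    inl_single_mem_of_inr_mem (b₀ := a₀) hd₁ hU (h₂ a₀) (by simp) a
  exact eq_top_of_singles_mem h₁ h₂

/-- **Step 4′.** Dually for a pure minus vector.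
research route, not a corollary; conditional on HC_CM plus one named minimal statement. [locator LIMITS-G25 §2.3] -/
theorem eq_top_of_inr_mem (hd₁ : ∀ a, d₁ a ≠ 0) (hd₂ : ∀ b, d₂ b ≠ 0)
    (hU : ∀ u ∈ U, ∀ X : Matrix ι ι L,
      ((fun a => d₁ a * (X *ᵥ u.2) a, fun b => d₂ b * (Xᵀ *ᵥ u.1) b) : (ι → L) × (ι → L)) ∈ U)
    {q : ι → L} {b₀ : ι} (hq : ((0, q) : (ι → L) × (ι → L)) ∈ U) (hb : q b₀ ≠ 0) : U = ⊤ := by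
  have h₁ : ∀ a, ((Pi.single a (1 : L), 0) : (ι → L) × (ι → L)) ∈ U :=
    inl_single_mem_of_inr_mem hd₁ hU hq hb
  exact eq_top_of_inl_mem (a₀ := b₀) hd₁ hd₂ hU (h₁ b₀) (by simp)

/-- **THEOREM (no common invariant subspace; LEMMA I^gen's algebraic core).**  Let `ι` have at least two elements and
let `d₁, d₂ : ι → L` have non-zero entries.  If a subspace `U ≤ L^ι × L^ι` is stable under every map
`(u₊, u₋) ↦ (d₁ • X u₋, d₂ • Xᵀ u₊)` (`X` ranging over ALL `ι × ι` matrices; weights entrywise), then `U = ⊥` or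
`U = ⊤`.  Proof: a non-zero `u ∈ U` is pure plus, pure minus (Steps 4, 4′), or mixed with `u₊ a₀ ≠ 0 ≠ u₋ b₀`; then
`J_{E_{a b₀}} u = (c e_a, c′ e_{b₀})` for `a ≠ a₀` and either `c′ = 0` (pure plus, `c ≠ 0`) or `J_{E_{a₀ b₀}}` of it is
the pure plus vector `c″ e_{a₀}`, `c″ ≠ 0`.  In the account: along a very general direction of the Weil family no
abelian subvariety of `Y₀ = E_ω⁶` survives to first order.
research route, not a corollary; conditional on HC_CM plus one named minimal statement. [locator LIMITS-G25 §2.3 LEMMA I^gen] -/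
theorem eq_bot_or_eq_top_of_forall_weilTangent_mem [Nontrivial ι]
    (hd₁ : ∀ a, d₁ a ≠ 0) (hd₂ : ∀ b, d₂ b ≠ 0)
    (hU : ∀ u ∈ U, ∀ X : Matrix ι ι L,
      ((fun a => d₁ a * (X *ᵥ u.2) a, fun b => d₂ b * (Xᵀ *ᵥ u.1) b) : (ι → L) × (ι → L)) ∈ U) :
    U = ⊥ ∨ U = ⊤ := by
  rcases eq_or_ne U ⊥ with h | h
  · exact Or.inl h
  right
  obtain ⟨u, hu, hne⟩ := (Submodule.ne_bot_iff U).1 h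
  by_cases h1 : u.1 = 0
  · -- pure minus
    have h2 : u.2 ≠ 0 := by
      intro h2; apply hne; ext i <;> simp [h1, h2]
    obtain ⟨b₀, hb⟩ := Function.ne_iff.1 h2
    have hq : ((0, u.2) : (ι → L) × (ι → L)) ∈ U := by
      have : ((0, u.2) : (ι → L) × (ι → L)) = u := by ext i <;> simp [h1]
      rw [this]; exact hu
    exact eq_top_of_inr_mem hd₁ hd₂ hU hq hb
  by_cases h2 : u.2 = 0
  · -- pure plus
    obtain ⟨a₀, ha⟩ := Function.ne_iff.1 h1
    have hp : ((u.1, 0) : (ι → L) × (ι → L)) ∈ U := by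
      have : ((u.1, 0) : (ι → L) × (ι → L)) = u := by ext i <;> simp [h2]
      rw [this]; exact hu
    exact eq_top_of_inl_mem hd₁ hd₂ hU hp ha
  -- mixed
  obtain ⟨a₀, ha⟩ := Function.ne_iff.1 h1
  obtain ⟨b₀, hb⟩ := Function.ne_iff.1 h2
  obtain ⟨a, haa⟩ := exists_ne a₀
  have hv := hU u hu (Matrix.single a b₀ 1)
  rw [weilTangent_single_apply] at hv
  -- hv : ((d₁ a * u.2 b₀) • e_a, (d₂ b₀ * u.1 a) • e_{b₀}) ∈ U
  by_cases hua : u.1 a = 0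
  · -- the image is pure plus with non-zero a-entry
    rw [hua, mul_zero, zero_smul] at hv
    refine eq_top_of_inl_mem (a₀ := a) hd₁ hd₂ hU hv ?_
    simp [mul_ne_zero (hd₁ a) hb]
  · -- apply J with X = E_{a₀ b₀} once more: the result is pure plus with non-zero a₀-entry
    have hw := hU _ hv (Matrix.single a₀ b₀ 1)
    rw [weilTangent_single_apply] at hw
    simp only [Pi.smul_apply, smul_eq_mul, Pi.single_eq_same, Pi.single_eq_of_ne haa.symm, mul_one,
      mul_zero, zero_smul] at hw
    refine eq_top_of_inl_mem (a₀ := a₀) hd₁ hd₂ hU hw ?_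
    simp [hd₁ a₀, hd₂ b₀, hua]

end

/-- Concrete instance recorded for the account: `ι = Fin 3` (so `L^ι × L^ι = L⁶`), any field, any non-zero weights —
in particular the cell's `d₊ = (1,1,1)`, `d₋⁻¹ = (1,1,½)` and the split sibling's `(1,1,1)`: the Weil tangent family
of `E_ω⁶` has no common proper non-zero invariant subspace on either side.
research route, not a corollary; conditional on HC_CM plus one named minimal statement. [locator LIMITS-G25 §2.3] -/
theorem fin3_eq_bot_or_eq_top {d₁ d₂ : Fin 3 → L} (hd₁ : ∀ a, d₁ a ≠ 0) (hd₂ : ∀ b, d₂ b ≠ 0)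
    {U : Submodule L ((Fin 3 → L) × (Fin 3 → L))}
    (hU : ∀ u ∈ U, ∀ X : Matrix (Fin 3) (Fin 3) L,
      ((fun a => d₁ a * (X *ᵥ u.2) a, fun b => d₂ b * (Xᵀ *ᵥ u.1) b) : (Fin 3 → L) × (Fin 3 → L)) ∈ U) :
    U = ⊥ ∨ U = ⊤ :=
  eq_bot_or_eq_top_of_forall_weilTangent_mem hd₁ hd₂ hU

end Summit.HodgeConjecture.Ring2AbelianAll.NonsplitGenericDirection
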